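import Summits.QuantumFields.YangMills.Theorems.BalabanUVNodesN18PolLimitsExistOfLocalTerms

/-!
# BalabanUVNodes ∕ N18 (node U3's kernel objects) — THE (1.21) EXISTENCE LETTER FROM THE LOCALIZED REPRESENTATION, PART 2: the LOCAL truncation-stability law — truncation by tree
# length `d(X) ≤ R` AND by distance to the window `distCT(cast site 0, X) ≤ R` (a K-UNIFORMLY FINITE family of terms), the two-sided tail `e^{−(min{κ,δ₀}∕2)R}`, and W1-19b's
# `PolLimitsExist` ∕ `PolLimitsExistOfRecord₁₃` from «the finitely many small terms near the window converge as `T^{(k+1)} ↗ ℤ⁴`» ([I] p. 264)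
# (Track A, DAG node N18 = NE5 ∕ node U3's shared existence letter; key K3⁸ `SpineGivenEndpointR13SepCoPHV` = stmt-QuantumFields-27366; cell `pub-ymgap`, WIDTH SEAT `pub-ymgap-dag-n18-w2` g9,
# FILE 6; `--kind proof --supports stmt-QuantumFields-27366 --as helper`, COUNT-NEUTRAL; THEOREMS ONLY, 0 `def`, 0 `sorry`)

WHY.  PART 1 (`…N18PolLimitsExistOfLocalTerms`) typed [I] p. 264's sentence «This limit exists by the localized representation (1.7)» with the truncation BY TREE LENGTH ONLY: its law asks
that `S_R(K) = Σ_{d(X) ≤ R} Π[term X](site z, site 0)` converge in `K` — a sum over ALL positions of the growing torus `T^{(k+1)}_K` (K-unbounded in number; it converges only thanks to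
the tails, i.e. it still mixes an infinite-volume statement into the law).  The honest LOCAL law truncates ALSO by the distance of `X` to the window: `S^{loc}_R(K) := Σ_{d(X) ≤ R,
distCT(cast site 0, X) ≤ R} Π[term X](site z, site 0)` runs over a K-UNIFORMLY FINITE family (the domains of bounded size near the origin), and its convergence as `K → ∞` is exactly the
volume independence of the cluster expansion's LOCAL terms ([II] (2.13)–(2.14)) read through the convergent minimizer — print's sentence, no more.  The price is a two-sided tail: a
discarded term has `d(X) > R` (`e^{−κd} ≤ e^{−(κ∕2)R}·e^{−(κ∕2)d}`) OR `dist > R` (`e^{−δ₀ dist} ≤ e^{−(δ₀∕2)R}·e^{−(δ₀∕2) dist}`), so the tail is resummed by dag-n22-w2's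
`eventually_le_of_softSum_domSys` at the HALVED rates `(κ∕2, δ₀∕2)` with weight `e^{−ηR}`, `η := min{κ, δ₀}∕2`.

WHAT.  §1 `exp_neg_mul_le_half_of_lt` (real arithmetic of the halved rates; the plain halving `e^{−ax} ≤ e^{−(a∕2)x}` is the tree's `…GhostLoopCountingGramWords.exp_full_le_half`, inlined here as `Real.exp_le_exp`).  §2 ★★ `eventually_abs_polWindow_sub_localTruncated_le` (terms `C²` + K-uniform soft
VALUE majorants at `(κ, δ₀)` ⇒ for every `R ≥ 0`, `∀ᶠ K, |Π^{(K)}_{k+1}(z) − S^{loc}_R(K)| ≤ C_E e^{12Mδ₁′}K₀(64,8)K₁(4,δ₀∕4)·e^{−ηR}·e^{−δ₁′|z|₁}`, `δ₁′ = ½min{δ₀∕2, (κ∕2)(4M)⁻¹}`;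
`κ∕4 ≥ κ₀(64,8)`).  §3 ★★★ `polLimitExists_localizedSum_of_localTruncationStable` (per `(k, hist)`: majorants + «every LOCAL truncated sum `S^{loc}_R(K)`, `R : ℕ`, converges in `K`» ⇒
`PolLimitExists F (k+1) (fun K => localizedSum F S emb k hist K) ρ bV`) · ★★★ `polLimitsExist_localizedSum_of_localTruncationStable` (W1-19b's letter on a window `W`) ·
★★★ `polLimitsExistOfRecord₁₃_of_localTruncationStable` (OF RECORD under W1-20's law).

HONEST FRAMING — what this is NOT.  Count-neutral bookkeeping (PART 1's §1–§2 lemmas + dag-n22-w2's resummation + completeness of ℝ); NO estimate of Bałaban's is proved or asserted — the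
soft VALUE majorants ((1.18) + the tails of p. 282 ∕ (4.35)–(4.37) pp. 290–291) and the LOCAL TRUNCATION STABILITY (volume independence of the cluster expansion's small near terms, [II]
(2.13)–(2.14), through the minimizer of [I] p. 264 — NODE A ∕ N10 content) are DISPLAYED hypotheses; nothing constructed; no letter OF RECORD inhabited; N18 ∕ N22 ∕ (D4) NOT discharged;
K3⁸ OPEN (v6), not claimed; counts UNMOVED (typed 28∕28 · discharged 5∕27 (A 5∕28)); one finite four-torus programme at fixed ε, Bałaban AS PRINTED; R4 closes the conditional finite-𝕋⁴
rung `BalabanLadder.UV` only — NOT ℝ⁴, NOT infinite volume, NOT OS, NOT a mass gap; the Clay problem is NOT proved by any of this.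

References (TYPES only): [I] = [Balaban1987RG1] (1.7) p. 261, (1.18) p. 263, (1.20)–(1.21) p. 264, p. 282, (4.35)–(4.36) p. 290, (4.37) p. 291, (5.10) p. 293; [II] = [Balaban1988RG2Cluster]
(2.13)–(2.14) pp. 14–15.  Imports PART 1 BY NAME; nothing re-declared.
-/

noncomputable section

namespace YMDAG.N18.PolLimitsExistOfLocalTerms

open Filter Metric
open scoped BigOperators Topology
open Literature.MathematicalPhysics.QuantumFieldTheory.Balaban1983to89
open Literature.MathematicalPhysics.QuantumFieldTheory.Balaban1983to89.T4Continuum (T4Family)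
open Literature.MathematicalPhysics.QuantumFieldTheory.Balaban1983to89.B12Sec2to5 (l1)
open Literature.MathematicalPhysics.QuantumFieldTheory.Balaban1983to89.B12PolarizationTensor120 (polComp expChart)
open Literature.MathematicalPhysics.QuantumFieldTheory.Balaban1983to89.Node00 (Stage13Params PolLimitExists polScalar polWindow siteOfInt MatA)
open Literature.MathematicalPhysics.QuantumFieldTheory.Balaban1983to89.Node00.U3OfKernels (histPrefix)
open Literature.MathematicalPhysics.QuantumFieldTheory.Balaban1983to89.Node00.U3KernelLetters (PolLimitsExist PolLimitsExistOfRecord₁₃ polLimitsExistOfRecord₁₃_iff_of_localizes)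
open Literature.MathematicalPhysics.QuantumFieldTheory.Balaban1983to89.Node00.LocalizedSum17 (localizedSum ReadingMaps Localizes17OfRecord₁₃)
open Literature.MathematicalPhysics.QuantumFieldTheory.Balaban1983to89.Node00.Sect2 (domSys domCount)
open Literature.MathematicalPhysics.QuantumFieldTheory.Balaban1983to89.Node00.W1 (ClusterTower)
open Literature.MathematicalPhysics.QuantumFieldTheory.Balaban1983to89.T4OutputRate (Window)
open Literature.MathematicalPhysics.QuantumFieldTheory.Balaban1983to89.B12Decay510 (delta1)
open Literature.MathematicalPhysics.QuantumFieldTheory.Balaban1983to89.B12Decay510Window (K₁)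
open Literature.MathematicalPhysics.QuantumFieldTheory.Balaban1983to89.B12Decay510Torus (distCT nearT distCT_nonneg)
open Literature.MathematicalPhysics.QuantumFieldTheory.Balaban1983to89.B12TreeDecay (K₀ kappa₀)
open Literature.MathematicalPhysics.QuantumFieldTheory.Balaban1983to89.TreeLengthTorus (TPt torusTreeLen torusTreeLen_nonneg)
open YMDAG.N22.WindowSoftTwoPoint (eventually_le_of_softSum_domSys)

/-! ## §1 Real arithmetic of the halved rates -/

/-- `e^{−a x} ≤ e^{−η R} · e^{−(a∕2) x}` for `a ≥ 0`, `0 ≤ R < x` and `η ≤ a∕2` (the discarded term's own decay pays the truncation). [folklore] -/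
theorem exp_neg_mul_le_half_of_lt {a x R η : ℝ} (ha : 0 ≤ a) (hR : 0 ≤ R) (hx : R < x) (hηa : η ≤ a / 2) :
    Real.exp (-a * x) ≤ Real.exp (-η * R) * Real.exp (-(a / 2) * x) := by
  rw [← Real.exp_add]
  exact Real.exp_le_exp.2 (by nlinarith)

/-! ## §2 The LOCAL truncation tail of W1-20's localized sum on def-T's catalogue of record, eventually in `K`, leaves DISCHARGED -/

section Tail

variable {𝔄 : Type*} [NormedRing 𝔄] [NormedAlgebra ℝ 𝔄] {V : Type*} [NormedAddCommGroup V] [NormedSpace ℝ V] {ι : Type*} [Fintype ι] {𝔸 : Type*}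
variable (F : T4Family) (m' : ℕ) (M : ℕ) [NeZero M] (hM : M = F.L ^ m')
variable (S : (K : ℕ) → ClusterTower (F.P K) 𝔸 M) (emb : ReadingMaps F 𝔄 𝔸) (ρ : V →L[ℝ] 𝔄) (bV : Module.Basis ι ℝ V)

include hM in
open Classical in
/-- ★★ **THE WINDOW MINUS ITS LOCAL `R`-TRUNCATION IS EVENTUALLY SMALL, UNIFORMLY: `|Π^{(K)}_{k+1}(z) − S^{loc}_R(K)| ≤ C·e^{−ηR}·e^{−δ₁′|z|₁}` for all large `K`**, `η = min{κ, δ₀}∕2`.  Here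
`S^{loc}_R(K) := Σ_{X ∈ 𝐃_{k+1}(T_K), d(X) ≤ R, distCT(cast site 0, X) ≤ R} Π[Re E^{(k+1)}_K(X; hist; ·)](site z, site 0)` runs over the domains of bounded size NEAR the window (K-uniformly
finitely many); the hypotheses are the terms' `C²` charts and the K-uniform soft VALUE majorants of the (D4) road at `(κ, δ₀)` (`κ, δ₀ > 0`, `κ∕4 ≥ κ₀(64,8)`, `R ≥ 0`);
`C = C_E e^{12Mδ₁′} K₀(64,8) K₁(4,δ₀∕4)`, `δ₁′ = ½min{δ₀∕2, (κ∕2)(4M)⁻¹}` — dag-n22-w2's `eventually_le_of_softSum_domSys` at the halved rates `(κ∕2, δ₀∕2)` with weight `e^{−ηR}`.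
[cite: Balaban1987RG1, (1.7) p.261, (1.18) p.263, (1.20)-(1.21) p.264 and (5.10) p.293] -/
theorem eventually_abs_polWindow_sub_localTruncated_le (k : ℕ) (hist : Fin (k + 1) → ℝ) (μ ν : Fin 4) (z : Fin 4 → ℤ) {R : ℝ} (hR : 0 ≤ R)
    (hC : ∀ (K : ℕ) (X : (domSys (F.P K) M (k + 1)).Dom), ContDiffAt ℝ 2 (expChart (fun W => (((S K) k).E hist (emb K k W) X).re) ρ) 0)
    {CE κ δ₀ : ℝ} (hCE : 0 ≤ CE) (hκ0 : 0 ≤ κ) (hδ₀ : 0 < δ₀) (hκ : kappa₀ (4 * 2 ^ 4) (2 * 4) ≤ κ / 2 / 2)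
    (hval : ∀ (K : ℕ) (X : (domSys (F.P K) M (k + 1)).Dom) (c : ι),
      let e : Site (F.P K) (k + 1) → TPt 4 (domCount (F.P K) M (k + 1) * M) := fun x i => (ZMod.cast (x i) : ZMod (domCount (F.P K) M (k + 1) * M))
      |polComp ℝ (expChart (fun W => (((S K) k).E hist (emb K k W) X).re) ρ) bV (Fin.cast (F.P_d K).symm μ) (siteOfInt F K (k + 1) z) c
          (Fin.cast (F.P_d K).symm ν) (siteOfInt F K (k + 1) 0) c| ≤
        CE * Real.exp (-κ * torusTreeLen X.1) * Real.exp (-δ₀ * distCT (domCount (F.P K) M (k + 1)) M (e (siteOfInt F K (k + 1) z)) (nearT (M := M) (e (siteOfInt F K (k + 1) z)) X)) *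
          Real.exp (-δ₀ * distCT (domCount (F.P K) M (k + 1)) M (e (siteOfInt F K (k + 1) 0)) (nearT (M := M) (e (siteOfInt F K (k + 1) 0)) X))) :
    ∀ᶠ K in atTop,
      |polWindow F K (k + 1) (localizedSum F S emb k hist K) ρ bV μ ν z -
          ∑ X ∈ Finset.univ.filter (fun X : (domSys (F.P K) M (k + 1)).Dom =>
              ¬ (R < torusTreeLen X.1 ∨ R < distCT (domCount (F.P K) M (k + 1)) M
                (fun i : Fin 4 => (ZMod.cast (siteOfInt F K (k + 1) 0 i) : ZMod (domCount (F.P K) M (k + 1) * M)))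
                (nearT (M := M) (fun i : Fin 4 => (ZMod.cast (siteOfInt F K (k + 1) 0 i) : ZMod (domCount (F.P K) M (k + 1) * M))) X))),
            polScalar (fun W => (((S K) k).E hist (emb K k W) X).re) ρ bV (Fin.cast (F.P_d K).symm μ) (siteOfInt F K (k + 1) z) (Fin.cast (F.P_d K).symm ν)
              (siteOfInt F K (k + 1) 0)| ≤
        CE * Real.exp (delta1 (δ₀ / 2) (κ / 2) ((M : ℝ) * 4) * ((M : ℝ) * 4) * 3) * K₀ (4 * 2 ^ 4) (2 * 4) * K₁ 4 (δ₀ / 2 / 2) * Real.exp (-(min κ δ₀ / 2) * R) *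
          Real.exp (-(delta1 (δ₀ / 2) (κ / 2) ((M : ℝ) * 4) * l1 z)) := by
  have hηκ : min κ δ₀ / 2 ≤ κ / 2 := by have := min_le_left κ δ₀; linarith
  have hηδ : min κ δ₀ / 2 ≤ δ₀ / 2 := by have := min_le_right κ δ₀; linarith
  have hhalf : ∀ {a x : ℝ}, 0 ≤ a → 0 ≤ x → Real.exp (-a * x) ≤ Real.exp (-(a / 2) * x) := fun ha hx =>
    Real.exp_le_exp.2 (by nlinarith)
  -- per-`K` Σ-shape: the window minus the local truncated sum IS the tail functional's kernel (PART 1 §2), bounded termwise by the indicator-weighted majorants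
  have hΔ : ∀ K, |polWindow F K (k + 1) (localizedSum F S emb k hist K) ρ bV μ ν z -
      ∑ X ∈ Finset.univ.filter (fun X : (domSys (F.P K) M (k + 1)).Dom =>
          ¬ (R < torusTreeLen X.1 ∨ R < distCT (domCount (F.P K) M (k + 1)) M
            (fun i : Fin 4 => (ZMod.cast (siteOfInt F K (k + 1) 0 i) : ZMod (domCount (F.P K) M (k + 1) * M)))
            (nearT (M := M) (fun i : Fin 4 => (ZMod.cast (siteOfInt F K (k + 1) 0 i) : ZMod (domCount (F.P K) M (k + 1) * M))) X))),
        polScalar (fun W => (((S K) k).E hist (emb K k W) X).re) ρ bV (Fin.cast (F.P_d K).symm μ) (siteOfInt F K (k + 1) z) (Fin.cast (F.P_d K).symm ν)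
          (siteOfInt F K (k + 1) 0)| ≤
      ∑ X : (domSys (F.P K) M (k + 1)).Dom, (if (R < torusTreeLen X.1 ∨ R < distCT (domCount (F.P K) M (k + 1)) M
            (fun i : Fin 4 => (ZMod.cast (siteOfInt F K (k + 1) 0 i) : ZMod (domCount (F.P K) M (k + 1) * M)))
            (nearT (M := M) (fun i : Fin 4 => (ZMod.cast (siteOfInt F K (k + 1) 0 i) : ZMod (domCount (F.P K) M (k + 1) * M))) X)) then
        CE * Real.exp (-κ * torusTreeLen X.1) *
          Real.exp (-δ₀ * distCT (domCount (F.P K) M (k + 1)) M (fun i : Fin 4 => (ZMod.cast (siteOfInt F K (k + 1) z i) : ZMod (domCount (F.P K) M (k + 1) * M)))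
            (nearT (M := M) (fun i : Fin 4 => (ZMod.cast (siteOfInt F K (k + 1) z i) : ZMod (domCount (F.P K) M (k + 1) * M))) X)) *
          Real.exp (-δ₀ * distCT (domCount (F.P K) M (k + 1)) M (fun i : Fin 4 => (ZMod.cast (siteOfInt F K (k + 1) 0 i) : ZMod (domCount (F.P K) M (k + 1) * M)))
            (nearT (M := M) (fun i : Fin 4 => (ZMod.cast (siteOfInt F K (k + 1) 0 i) : ZMod (domCount (F.P K) M (k + 1) * M))) X)) else 0) := by
    intro K
    have e1 : polWindow F K (k + 1) (localizedSum F S emb k hist K) ρ bV μ ν z =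
        polScalar (fun U => ∑ X : (domSys (F.P K) M (k + 1)).Dom, (fun X W => (((S K) k).E hist (emb K k W) X).re) X U) ρ bV (Fin.cast (F.P_d K).symm μ)
          (siteOfInt F K (k + 1) z) (Fin.cast (F.P_d K).symm ν) (siteOfInt F K (k + 1) 0) := rfl
    rw [e1, polScalar_sum_eq_truncated_add_tail _ ρ bV (hC K) (fun X : (domSys (F.P K) M (k + 1)).Dom =>
      R < torusTreeLen X.1 ∨ R < distCT (domCount (F.P K) M (k + 1)) M
        (fun i : Fin 4 => (ZMod.cast (siteOfInt F K (k + 1) 0 i) : ZMod (domCount (F.P K) M (k + 1) * M)))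
        (nearT (M := M) (fun i : Fin 4 => (ZMod.cast (siteOfInt F K (k + 1) 0 i) : ZMod (domCount (F.P K) M (k + 1) * M))) X)), add_sub_cancel_left]
    exact abs_polScalar_tail_le_sum_indicator _ ρ bV (hC K) _ _
      (fun X => mul_nonneg (mul_nonneg (mul_nonneg hCE (Real.exp_pos _).le) (Real.exp_pos _).le) (Real.exp_pos _).le) _ _ _ _ (fun X _ c => hval K X c)
  -- the indicator-weighted majorant is a soft majorant at the halved rates `(κ∕2, δ₀∕2)` with weight `e^{−ηR}`
  have hκ' : kappa₀ (4 * 2 ^ 4) (2 * 4) ≤ κ / 2 / 2 := hκ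
  have h := eventually_le_of_softSum_domSys F (k + 1) m' M hM _ _ hCE (Real.exp_pos (-(min κ δ₀ / 2) * R)).le (half_pos hδ₀) hκ' z hΔ (fun K X => ?_)
  · exact h
  · dsimp only
    have hd0 := torusTreeLen_nonneg X.1
    have hdz := distCT_nonneg (N := domCount (F.P K) M (k + 1)) (M := M)
      (fun i : Fin 4 => (ZMod.cast (siteOfInt F K (k + 1) z i) : ZMod (domCount (F.P K) M (k + 1) * M)))
      (nearT (M := M) (fun i : Fin 4 => (ZMod.cast (siteOfInt F K (k + 1) z i) : ZMod (domCount (F.P K) M (k + 1) * M))) X)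
    have hd00 := distCT_nonneg (N := domCount (F.P K) M (k + 1)) (M := M)
      (fun i : Fin 4 => (ZMod.cast (siteOfInt F K (k + 1) 0 i) : ZMod (domCount (F.P K) M (k + 1) * M)))
      (nearT (M := M) (fun i : Fin 4 => (ZMod.cast (siteOfInt F K (k + 1) 0 i) : ZMod (domCount (F.P K) M (k + 1) * M))) X)
    split_ifs with hp
    · rcases hp with hRd | hRdist
      · -- `d(X) > R`: the tree-length factor pays `e^{−ηR}`, the two tails halve for free
        have h1 := exp_neg_mul_le_half_of_lt hκ0 hR hRd hηκ
        have h2 := hhalf hδ₀.le hdz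
        have h3 := hhalf hδ₀.le hd00
        calc _ ≤ CE * (Real.exp (-(min κ δ₀ / 2) * R) * Real.exp (-(κ / 2) * torusTreeLen X.1)) * Real.exp (-(δ₀ / 2) * _) * Real.exp (-(δ₀ / 2) * _) :=
            mul_le_mul (mul_le_mul (mul_le_mul_of_nonneg_left h1 hCE) h2 (Real.exp_pos _).le (mul_nonneg hCE (mul_nonneg (Real.exp_pos _).le (Real.exp_pos _).le)))
              h3 (Real.exp_pos _).le (mul_nonneg (mul_nonneg hCE (mul_nonneg (Real.exp_pos _).le (Real.exp_pos _).le)) (Real.exp_pos _).le)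
          _ = _ := by ring
      · -- `dist(site 0, X) > R`: the second tail pays `e^{−ηR}`, the tree length and the first tail halve for free
        have h1 := hhalf hκ0 hd0
        have h2 := hhalf hδ₀.le hdz
        have h3 := exp_neg_mul_le_half_of_lt hδ₀.le hR hRdist hηδ
        calc _ ≤ CE * Real.exp (-(κ / 2) * torusTreeLen X.1) * Real.exp (-(δ₀ / 2) * _) * (Real.exp (-(min κ δ₀ / 2) * R) * Real.exp (-(δ₀ / 2) * _)) :=
            mul_le_mul (mul_le_mul (mul_le_mul_of_nonneg_left h1 hCE) h2 (Real.exp_pos _).le (mul_nonneg hCE (Real.exp_pos _).le))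
              h3 (Real.exp_pos _).le (mul_nonneg (mul_nonneg hCE (Real.exp_pos _).le) (Real.exp_pos _).le)
          _ = _ := by ring
    · exact mul_nonneg (mul_nonneg (mul_nonneg (mul_nonneg hCE (Real.exp_pos _).le) (Real.exp_pos _).le) (Real.exp_pos _).le) (Real.exp_pos _).le

end Tail

/-! ## §3 THE (1.21) EXISTENCE LETTER from LOCAL truncation stability + soft value majorants -/

section Letter

variable {𝔄 : Type*} [NormedRing 𝔄] [NormedAlgebra ℝ 𝔄] {V : Type*} [NormedAddCommGroup V] [NormedSpace ℝ V] {ι : Type*} [Fintype ι] {𝔸 : Type*}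
variable (F : T4Family) (m' : ℕ) (M : ℕ) [NeZero M] (hM : M = F.L ^ m')
variable (S : (K : ℕ) → ClusterTower (F.P K) 𝔸 M) (emb : ReadingMaps F 𝔄 𝔸) (ρ : V →L[ℝ] 𝔄) (bV : Module.Basis ι ℝ V)

include hM in
open Classical in
/-- ★★★ **«THIS LIMIT EXISTS BY THE LOCALIZED REPRESENTATION (1.7)», LOCAL LAW** ([I] p. 264), per level `k` and history `hist`: IF the (2.13) terms read in def-B's chart are `C²` at
`0`, obey K-uniform soft VALUE majorants (`C_E` may depend on the entry; `κ, δ₀ > 0`, `κ∕4 ≥ κ₀(64,8)`), and for every kernel entry and every `R : ℕ` the LOCAL `R`-truncated sum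
`S^{loc}_R(K)` — over the domains `X` with `d(X) ≤ R` AND `distCT(cast site 0, X) ≤ R`, a K-uniformly finite family — CONVERGES as `K → ∞` (volume independence of the small near
terms — DISPLAYED, NODE A ∕ N10 content), THEN `PolLimitExists F (k+1) (fun K => localizedSum F S emb k hist K) ρ bV`.
[cite: Balaban1987RG1, (1.7) p.261 and (1.20)-(1.21) p.264; Balaban1988RG2Cluster, (2.13)-(2.14) pp.14-15] -/
theorem polLimitExists_localizedSum_of_localTruncationStable (k : ℕ) (hist : Fin (k + 1) → ℝ)
    (hC : ∀ (K : ℕ) (X : (domSys (F.P K) M (k + 1)).Dom), ContDiffAt ℝ 2 (expChart (fun W => (((S K) k).E hist (emb K k W) X).re) ρ) 0)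
    {κ δ₀ : ℝ} (hκ0 : 0 < κ) (hδ₀ : 0 < δ₀) (hκ : kappa₀ (4 * 2 ^ 4) (2 * 4) ≤ κ / 2 / 2)
    (hval : ∀ (μ ν : Fin 4) (z : Fin 4 → ℤ), ∃ CE : ℝ, 0 ≤ CE ∧ ∀ (K : ℕ) (X : (domSys (F.P K) M (k + 1)).Dom) (c : ι),
      let e : Site (F.P K) (k + 1) → TPt 4 (domCount (F.P K) M (k + 1) * M) := fun x i => (ZMod.cast (x i) : ZMod (domCount (F.P K) M (k + 1) * M))
      |polComp ℝ (expChart (fun W => (((S K) k).E hist (emb K k W) X).re) ρ) bV (Fin.cast (F.P_d K).symm μ) (siteOfInt F K (k + 1) z) c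
          (Fin.cast (F.P_d K).symm ν) (siteOfInt F K (k + 1) 0) c| ≤
        CE * Real.exp (-κ * torusTreeLen X.1) * Real.exp (-δ₀ * distCT (domCount (F.P K) M (k + 1)) M (e (siteOfInt F K (k + 1) z)) (nearT (M := M) (e (siteOfInt F K (k + 1) z)) X)) *
          Real.exp (-δ₀ * distCT (domCount (F.P K) M (k + 1)) M (e (siteOfInt F K (k + 1) 0)) (nearT (M := M) (e (siteOfInt F K (k + 1) 0)) X)))
    (hstab : ∀ (μ ν : Fin 4) (z : Fin 4 → ℤ) (R : ℕ), ∃ s : ℝ, Tendsto (fun K : ℕ =>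
      ∑ X ∈ Finset.univ.filter (fun X : (domSys (F.P K) M (k + 1)).Dom =>
          ¬ ((R : ℝ) < torusTreeLen X.1 ∨ (R : ℝ) < distCT (domCount (F.P K) M (k + 1)) M
            (fun i : Fin 4 => (ZMod.cast (siteOfInt F K (k + 1) 0 i) : ZMod (domCount (F.P K) M (k + 1) * M)))
            (nearT (M := M) (fun i : Fin 4 => (ZMod.cast (siteOfInt F K (k + 1) 0 i) : ZMod (domCount (F.P K) M (k + 1) * M))) X))),
        polScalar (fun W => (((S K) k).E hist (emb K k W) X).re) ρ bV (Fin.cast (F.P_d K).symm μ) (siteOfInt F K (k + 1) z) (Fin.cast (F.P_d K).symm ν)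
          (siteOfInt F K (k + 1) 0)) atTop (𝓝 s)) :
    PolLimitExists F (k + 1) (fun K => localizedSum F S emb k hist K) ρ bV := by
  intro μ ν z
  obtain ⟨CE, hCE, hv⟩ := hval μ ν z
  refine exists_tendsto_of_forall_eventually_near_tendsto _ fun ε hε => ?_
  set Cst : ℝ := CE * Real.exp (delta1 (δ₀ / 2) (κ / 2) ((M : ℝ) * 4) * ((M : ℝ) * 4) * 3) * K₀ (4 * 2 ^ 4) (2 * 4) * K₁ 4 (δ₀ / 2 / 2) *
    Real.exp (-(delta1 (δ₀ / 2) (κ / 2) ((M : ℝ) * 4) * l1 z)) with hCst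
  have hη : 0 < min κ δ₀ / 2 := by have := lt_min hκ0 hδ₀; linarith
  have hlim : Tendsto (fun R : ℕ => Cst * Real.exp (-(min κ δ₀ / 2) * (R : ℝ))) atTop (𝓝 (Cst * 0)) := by
    refine tendsto_const_nhds.mul ?_
    have h1 : Tendsto (fun R : ℕ => -(min κ δ₀ / 2) * (R : ℝ)) atTop atBot :=
      (tendsto_natCast_atTop_atTop).const_mul_atTop_of_neg (by linarith)
    exact Real.tendsto_exp_atBot.comp h1
  rw [mul_zero] at hlim
  obtain ⟨R, hRR⟩ := (Metric.tendsto_atTop.1 hlim ε hε)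
  have hRε : Cst * Real.exp (-(min κ δ₀ / 2) * (R : ℝ)) ≤ ε := by
    have := hRR R le_rfl
    rw [Real.dist_eq, sub_zero] at this
    exact (le_abs_self _).trans this.le
  obtain ⟨s, hs⟩ := hstab μ ν z R
  refine ⟨_, s, hs, ?_⟩
  filter_upwards [eventually_abs_polWindow_sub_localTruncated_le F m' M hM S emb ρ bV k hist μ ν z (R := (R : ℝ)) (Nat.cast_nonneg R) hC hCE hκ0.le hδ₀ hκ hv]
    with K hK
  refine hK.trans (le_trans (le_of_eq ?_) hRε)
  rw [hCst]; ring

include hM in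
open Classical in
/-- ★★★ **W1-19b's EXISTENCE LETTER `PolLimitsExist F (localizedSum F S emb) ρ bV W` FROM LOCAL TRUNCATION STABILITY + SOFT VALUE MAJORANTS** — for every coupling sequence `g` of the
window `W` and every level `k`, the hypotheses of `polLimitExists_localizedSum_of_localTruncationStable` at `hist := histPrefix g k`.
[cite: Balaban1987RG1, (1.7) p.261 and (1.21) p.264; Balaban1988RG2Cluster, (2.14) p.15] -/
theorem polLimitsExist_localizedSum_of_localTruncationStable (W : Set (ℕ → ℝ)) {κ δ₀ : ℝ} (hκ0 : 0 < κ) (hδ₀ : 0 < δ₀)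
    (hκ : kappa₀ (4 * 2 ^ 4) (2 * 4) ≤ κ / 2 / 2)
    (hC : ∀ g ∈ W, ∀ (k K : ℕ) (X : (domSys (F.P K) M (k + 1)).Dom), ContDiffAt ℝ 2 (expChart (fun W' => (((S K) k).E (histPrefix g k) (emb K k W') X).re) ρ) 0)
    (hval : ∀ g ∈ W, ∀ (k : ℕ) (μ ν : Fin 4) (z : Fin 4 → ℤ), ∃ CE : ℝ, 0 ≤ CE ∧ ∀ (K : ℕ) (X : (domSys (F.P K) M (k + 1)).Dom) (c : ι),
      let e : Site (F.P K) (k + 1) → TPt 4 (domCount (F.P K) M (k + 1) * M) := fun x i => (ZMod.cast (x i) : ZMod (domCount (F.P K) M (k + 1) * M))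
      |polComp ℝ (expChart (fun W' => (((S K) k).E (histPrefix g k) (emb K k W') X).re) ρ) bV (Fin.cast (F.P_d K).symm μ) (siteOfInt F K (k + 1) z) c
          (Fin.cast (F.P_d K).symm ν) (siteOfInt F K (k + 1) 0) c| ≤
        CE * Real.exp (-κ * torusTreeLen X.1) * Real.exp (-δ₀ * distCT (domCount (F.P K) M (k + 1)) M (e (siteOfInt F K (k + 1) z)) (nearT (M := M) (e (siteOfInt F K (k + 1) z)) X)) *
          Real.exp (-δ₀ * distCT (domCount (F.P K) M (k + 1)) M (e (siteOfInt F K (k + 1) 0)) (nearT (M := M) (e (siteOfInt F K (k + 1) 0)) X)))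
    (hstab : ∀ g ∈ W, ∀ (k : ℕ) (μ ν : Fin 4) (z : Fin 4 → ℤ) (R : ℕ), ∃ s : ℝ, Tendsto (fun K : ℕ =>
      ∑ X ∈ Finset.univ.filter (fun X : (domSys (F.P K) M (k + 1)).Dom =>
          ¬ ((R : ℝ) < torusTreeLen X.1 ∨ (R : ℝ) < distCT (domCount (F.P K) M (k + 1)) M
            (fun i : Fin 4 => (ZMod.cast (siteOfInt F K (k + 1) 0 i) : ZMod (domCount (F.P K) M (k + 1) * M)))
            (nearT (M := M) (fun i : Fin 4 => (ZMod.cast (siteOfInt F K (k + 1) 0 i) : ZMod (domCount (F.P K) M (k + 1) * M))) X))),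
        polScalar (fun W' => (((S K) k).E (histPrefix g k) (emb K k W') X).re) ρ bV (Fin.cast (F.P_d K).symm μ) (siteOfInt F K (k + 1) z) (Fin.cast (F.P_d K).symm ν)
          (siteOfInt F K (k + 1) 0)) atTop (𝓝 s)) :
    PolLimitsExist F (localizedSum F S emb) ρ bV W :=
  fun g hg k => polLimitExists_localizedSum_of_localTruncationStable F m' M hM S emb ρ bV k (histPrefix g k) (hC g hg k) hκ0 hδ₀ hκ (hval g hg k) (hstab g hg k)

end Letter

/-! ## §3b AT THE RECORD, Stage 13: `PolLimitsExistOfRecord₁₃` from the LOCAL law under W1-20's law -/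

section Record

open scoped Matrix.Norms.L2Operator

variable {𝔸 : Type*} (F : T4Family) (N : ℕ) [NeZero N] (m' : ℕ) (M : ℕ) [NeZero M] (hM : M = F.L ^ m')

include hM in
open Classical in
/-- ★★★ **THE (1.21) EXISTENCE LETTER OF RECORD FROM THE LOCAL TRUNCATION-STABILITY LAW**: under W1-20's `Localizes17OfRecord₁₃ F N θ S emb`, the terms' `C²` charts in the record's
β-chart, K-uniform soft value majorants and the convergence of every LOCAL truncated window sum ⇒ `PolLimitsExistOfRecord₁₃ F N θ` (def-W1's `polLimitsExistOfRecord₁₃_iff_of_localizes`).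
[cite: Balaban1987RG1, (1.7) p.261 and (1.21) p.264; Balaban1988RG2Cluster, (2.14) p.15] -/
theorem polLimitsExistOfRecord₁₃_of_localTruncationStable (θ : Stage13Params F N) (S : (K : ℕ) → ClusterTower (F.P K) 𝔸 M) (emb : ReadingMaps F (MatA N) 𝔸)
    (hloc : Localizes17OfRecord₁₃ F N θ S emb) {κ δ₀ : ℝ} (hκ0 : 0 < κ) (hδ₀ : 0 < δ₀) (hκ : kappa₀ (4 * 2 ^ 4) (2 * 4) ≤ κ / 2 / 2)
    (hC : letI := θ.instVβ₁; letI := θ.instVβ₂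
      ∀ g ∈ Window θ.γ, ∀ (k K : ℕ) (X : (domSys (F.P K) M (k + 1)).Dom),
        ContDiffAt ℝ 2 (expChart (fun W' => (((S K) k).E (histPrefix g k) (emb K k W') X).re) θ.ρ8) 0)
    (hval : letI := θ.instVβ₁; letI := θ.instVβ₂; letI := θ.instιβ
      ∀ g ∈ Window θ.γ, ∀ (k : ℕ) (μ ν : Fin 4) (z : Fin 4 → ℤ), ∃ CE : ℝ, 0 ≤ CE ∧ ∀ (K : ℕ) (X : (domSys (F.P K) M (k + 1)).Dom) (c : θ.ιβ),
        let e : Site (F.P K) (k + 1) → TPt 4 (domCount (F.P K) M (k + 1) * M) := fun x i => (ZMod.cast (x i) : ZMod (domCount (F.P K) M (k + 1) * M))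
        |polComp ℝ (expChart (fun W' => (((S K) k).E (histPrefix g k) (emb K k W') X).re) θ.ρ8) θ.bV (Fin.cast (F.P_d K).symm μ) (siteOfInt F K (k + 1) z) c
            (Fin.cast (F.P_d K).symm ν) (siteOfInt F K (k + 1) 0) c| ≤
          CE * Real.exp (-κ * torusTreeLen X.1) * Real.exp (-δ₀ * distCT (domCount (F.P K) M (k + 1)) M (e (siteOfInt F K (k + 1) z)) (nearT (M := M) (e (siteOfInt F K (k + 1) z)) X)) *
            Real.exp (-δ₀ * distCT (domCount (F.P K) M (k + 1)) M (e (siteOfInt F K (k + 1) 0)) (nearT (M := M) (e (siteOfInt F K (k + 1) 0)) X)))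
    (hstab : letI := θ.instVβ₁; letI := θ.instVβ₂; letI := θ.instιβ
      ∀ g ∈ Window θ.γ, ∀ (k : ℕ) (μ ν : Fin 4) (z : Fin 4 → ℤ) (R : ℕ), ∃ s : ℝ, Tendsto (fun K : ℕ =>
        ∑ X ∈ Finset.univ.filter (fun X : (domSys (F.P K) M (k + 1)).Dom =>
            ¬ ((R : ℝ) < torusTreeLen X.1 ∨ (R : ℝ) < distCT (domCount (F.P K) M (k + 1)) M
              (fun i : Fin 4 => (ZMod.cast (siteOfInt F K (k + 1) 0 i) : ZMod (domCount (F.P K) M (k + 1) * M)))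
              (nearT (M := M) (fun i : Fin 4 => (ZMod.cast (siteOfInt F K (k + 1) 0 i) : ZMod (domCount (F.P K) M (k + 1) * M))) X))),
          polScalar (fun W' => (((S K) k).E (histPrefix g k) (emb K k W') X).re) θ.ρ8 θ.bV (Fin.cast (F.P_d K).symm μ) (siteOfInt F K (k + 1) z) (Fin.cast (F.P_d K).symm ν)
            (siteOfInt F K (k + 1) 0)) atTop (𝓝 s)) :
    PolLimitsExistOfRecord₁₃ F N θ := by
  letI := θ.instVβ₁; letI := θ.instVβ₂; letI := θ.instιβ
  exact (polLimitsExistOfRecord₁₃_iff_of_localizes F N θ S emb hloc).2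
    (polLimitsExist_localizedSum_of_localTruncationStable F m' M hM S emb θ.ρ8 θ.bV (Window θ.γ) hκ0 hδ₀ hκ hC hval hstab)

end Record

end YMDAG.N18.PolLimitsExistOfLocalTerms

end
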